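import Summits.Parity.GeneralizedHardyLittlewood.Theorems.Dhl42BandsGradeA
import Summits.Parity.GeneralizedHardyLittlewood.Theorems.Dhl42BandsGradeB
import Summits.Parity.GeneralizedHardyLittlewood.Theorems.Dhl42BandsGradeC
import Summits.Parity.GeneralizedHardyLittlewood.Theorems.Dhl42TablesPhi

/-!
# DHL[42,2] certificate — the two reductions (banded ⊆ graded) and the cover fact of Section 7.3 / Lemma 6.3

`tauFband_low_eq` (below `u = 1/10` the banded F-columns do not depend on the band — the second
reduction), `banded_subset_gradedF/G` (the banded regions `Ω, Ω'` are subsets of the original graded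
regions — so certifying on them is legitimate), band monotonicity `tauFband_le_01/12`, the sentinel
facts, and the cover fact: `Esets_cover : S·R_42 ∖ Ω ⊆ ⋃_m Esets m` (every point violating a banded
constraint lies in one of the 126 members, Lemma 6.3) and `binSets_cover` (each member's bins cover
its fibre range).

Origin: the verbatim leg `Dhl42/TpY4Dhl42.lean` of the DHL[42,2] certificate package (pub-dhl42
bundle, archive blob `18cce9e3`; paper snapshot = `paper/main.tex` v1), lines :1936–:2231;
statements and proofs unchanged except: namespace `TpY4Dhl42` →
`Summit.Parity.GeneralizedHardyLittlewood.Theorems.Dhl42`, the package's `simplexSet n B` replaced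
by the tree's definitionally equal `Literature.NumberTheory.Sieve.scaledSimplex n B`
(`PolymathBoundedGaps.lean`), docstrings added where missing; four deprecated `push_neg` calls
replaced by `push Not` and one unused `simp` argument dropped (the linter warnings of the package
build at :2118 :2144 :2158 :2186 :2228).

Declarations (10): `tauFband_low_eq`, `banded_subset_gradedF`, `banded_subset_gradedG`,
`tauFband_le_01`, `tauFband_le_12`, `uvecE_sentinel`, `tauFbandE_sentinel`, `cover_of_band`,
`Esets_cover`, `binSets_cover`.
-/

open Literature.NumberTheory.Sieve (scaledSimplex)

namespace Summit.Parity.GeneralizedHardyLittlewood.Theorems.Dhl42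

/-- Below `u = 1/10` (the 18 lowest levels) the banded F-columns do not
depend on the band (Section 7.1's second reduction). -/
theorem tauFband_low_eq : ∀ (g : Fin 3) (l : Fin 18),
    tauFband g (Fin.castLE (by omega) l) = tauFband 0 (Fin.castLE (by omega) l) := by
  intro g l
  fin_cases g
  · rfl
  · fin_cases l
    · show tauFbandE 1 ⟨0, by norm_num⟩ = tauFbandE 0 ⟨0, by norm_num⟩
      norm_num [tauFbandE, tauFbandA, tauFbandB, Matrix.cons_val_two, Matrix.head_cons, Matrix.tail_cons]
    · show tauFbandE 1 ⟨1, by norm_num⟩ = tauFbandE 0 ⟨1, by norm_num⟩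
      norm_num [tauFbandE, tauFbandA, tauFbandB, Matrix.cons_val_two, Matrix.head_cons, Matrix.tail_cons]
    · show tauFbandE 1 ⟨2, by norm_num⟩ = tauFbandE 0 ⟨2, by norm_num⟩
      norm_num [tauFbandE, tauFbandA, tauFbandB, Matrix.cons_val_two, Matrix.head_cons, Matrix.tail_cons]
    · show tauFbandE 1 ⟨3, by norm_num⟩ = tauFbandE 0 ⟨3, by norm_num⟩
      norm_num [tauFbandE, tauFbandA, tauFbandB, Matrix.cons_val_two, Matrix.head_cons, Matrix.tail_cons]
    · show tauFbandE 1 ⟨4, by norm_num⟩ = tauFbandE 0 ⟨4, by norm_num⟩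
      norm_num [tauFbandE, tauFbandA, tauFbandB, Matrix.cons_val_two, Matrix.head_cons, Matrix.tail_cons]
    · show tauFbandE 1 ⟨5, by norm_num⟩ = tauFbandE 0 ⟨5, by norm_num⟩
      norm_num [tauFbandE, tauFbandA, tauFbandB, Matrix.cons_val_two, Matrix.head_cons, Matrix.tail_cons]
    · show tauFbandE 1 ⟨6, by norm_num⟩ = tauFbandE 0 ⟨6, by norm_num⟩
      norm_num [tauFbandE, tauFbandA, tauFbandB, Matrix.cons_val_two, Matrix.head_cons, Matrix.tail_cons]
    · show tauFbandE 1 ⟨7, by norm_num⟩ = tauFbandE 0 ⟨7, by norm_num⟩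
      norm_num [tauFbandE, tauFbandA, tauFbandB, Matrix.cons_val_two, Matrix.head_cons, Matrix.tail_cons]
    · show tauFbandE 1 ⟨8, by norm_num⟩ = tauFbandE 0 ⟨8, by norm_num⟩
      norm_num [tauFbandE, tauFbandA, tauFbandB, Matrix.cons_val_two, Matrix.head_cons, Matrix.tail_cons]
    · show tauFbandE 1 ⟨9, by norm_num⟩ = tauFbandE 0 ⟨9, by norm_num⟩
      norm_num [tauFbandE, tauFbandA, tauFbandB, Matrix.cons_val_two, Matrix.head_cons, Matrix.tail_cons]
    · show tauFbandE 1 ⟨10, by norm_num⟩ = tauFbandE 0 ⟨10, by norm_num⟩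
      norm_num [tauFbandE, tauFbandA, tauFbandB, Matrix.cons_val_two, Matrix.head_cons, Matrix.tail_cons]
    · show tauFbandE 1 ⟨11, by norm_num⟩ = tauFbandE 0 ⟨11, by norm_num⟩
      norm_num [tauFbandE, tauFbandA, tauFbandB, Matrix.cons_val_two, Matrix.head_cons, Matrix.tail_cons]
    · show tauFbandE 1 ⟨12, by norm_num⟩ = tauFbandE 0 ⟨12, by norm_num⟩
      norm_num [tauFbandE, tauFbandA, tauFbandB, Matrix.cons_val_two, Matrix.head_cons, Matrix.tail_cons]
    · show tauFbandE 1 ⟨13, by norm_num⟩ = tauFbandE 0 ⟨13, by norm_num⟩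
      norm_num [tauFbandE, tauFbandA, tauFbandB, Matrix.cons_val_two, Matrix.head_cons, Matrix.tail_cons]
    · show tauFbandE 1 ⟨14, by norm_num⟩ = tauFbandE 0 ⟨14, by norm_num⟩
      norm_num [tauFbandE, tauFbandA, tauFbandB, Matrix.cons_val_two, Matrix.head_cons, Matrix.tail_cons]
    · show tauFbandE 1 ⟨15, by norm_num⟩ = tauFbandE 0 ⟨15, by norm_num⟩
      norm_num [tauFbandE, tauFbandA, tauFbandB, Matrix.cons_val_two, Matrix.head_cons, Matrix.tail_cons]
    · show tauFbandE 1 ⟨16, by norm_num⟩ = tauFbandE 0 ⟨16, by norm_num⟩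
      norm_num [tauFbandE, tauFbandA, tauFbandB, Matrix.cons_val_two, Matrix.head_cons, Matrix.tail_cons]
    · show tauFbandE 1 ⟨17, by norm_num⟩ = tauFbandE 0 ⟨17, by norm_num⟩
      norm_num [tauFbandE, tauFbandA, tauFbandB, Matrix.cons_val_two, Matrix.head_cons, Matrix.tail_cons]
  · fin_cases l
    · show tauFbandE 2 ⟨0, by norm_num⟩ = tauFbandE 0 ⟨0, by norm_num⟩
      norm_num [tauFbandE, tauFbandA, tauFbandC, Matrix.cons_val_two, Matrix.head_cons, Matrix.tail_cons]
    · show tauFbandE 2 ⟨1, by norm_num⟩ = tauFbandE 0 ⟨1, by norm_num⟩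
      norm_num [tauFbandE, tauFbandA, tauFbandC, Matrix.cons_val_two, Matrix.head_cons, Matrix.tail_cons]
    · show tauFbandE 2 ⟨2, by norm_num⟩ = tauFbandE 0 ⟨2, by norm_num⟩
      norm_num [tauFbandE, tauFbandA, tauFbandC, Matrix.cons_val_two, Matrix.head_cons, Matrix.tail_cons]
    · show tauFbandE 2 ⟨3, by norm_num⟩ = tauFbandE 0 ⟨3, by norm_num⟩
      norm_num [tauFbandE, tauFbandA, tauFbandC, Matrix.cons_val_two, Matrix.head_cons, Matrix.tail_cons]
    · show tauFbandE 2 ⟨4, by norm_num⟩ = tauFbandE 0 ⟨4, by norm_num⟩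
      norm_num [tauFbandE, tauFbandA, tauFbandC, Matrix.cons_val_two, Matrix.head_cons, Matrix.tail_cons]
    · show tauFbandE 2 ⟨5, by norm_num⟩ = tauFbandE 0 ⟨5, by norm_num⟩
      norm_num [tauFbandE, tauFbandA, tauFbandC, Matrix.cons_val_two, Matrix.head_cons, Matrix.tail_cons]
    · show tauFbandE 2 ⟨6, by norm_num⟩ = tauFbandE 0 ⟨6, by norm_num⟩
      norm_num [tauFbandE, tauFbandA, tauFbandC, Matrix.cons_val_two, Matrix.head_cons, Matrix.tail_cons]
    · show tauFbandE 2 ⟨7, by norm_num⟩ = tauFbandE 0 ⟨7, by norm_num⟩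
      norm_num [tauFbandE, tauFbandA, tauFbandC, Matrix.cons_val_two, Matrix.head_cons, Matrix.tail_cons]
    · show tauFbandE 2 ⟨8, by norm_num⟩ = tauFbandE 0 ⟨8, by norm_num⟩
      norm_num [tauFbandE, tauFbandA, tauFbandC, Matrix.cons_val_two, Matrix.head_cons, Matrix.tail_cons]
    · show tauFbandE 2 ⟨9, by norm_num⟩ = tauFbandE 0 ⟨9, by norm_num⟩
      norm_num [tauFbandE, tauFbandA, tauFbandC, Matrix.cons_val_two, Matrix.head_cons, Matrix.tail_cons]
    · show tauFbandE 2 ⟨10, by norm_num⟩ = tauFbandE 0 ⟨10, by norm_num⟩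
      norm_num [tauFbandE, tauFbandA, tauFbandC, Matrix.cons_val_two, Matrix.head_cons, Matrix.tail_cons]
    · show tauFbandE 2 ⟨11, by norm_num⟩ = tauFbandE 0 ⟨11, by norm_num⟩
      norm_num [tauFbandE, tauFbandA, tauFbandC, Matrix.cons_val_two, Matrix.head_cons, Matrix.tail_cons]
    · show tauFbandE 2 ⟨12, by norm_num⟩ = tauFbandE 0 ⟨12, by norm_num⟩
      norm_num [tauFbandE, tauFbandA, tauFbandC, Matrix.cons_val_two, Matrix.head_cons, Matrix.tail_cons]
    · show tauFbandE 2 ⟨13, by norm_num⟩ = tauFbandE 0 ⟨13, by norm_num⟩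
      norm_num [tauFbandE, tauFbandA, tauFbandC, Matrix.cons_val_two, Matrix.head_cons, Matrix.tail_cons]
    · show tauFbandE 2 ⟨14, by norm_num⟩ = tauFbandE 0 ⟨14, by norm_num⟩
      norm_num [tauFbandE, tauFbandA, tauFbandC, Matrix.cons_val_two, Matrix.head_cons, Matrix.tail_cons]
    · show tauFbandE 2 ⟨15, by norm_num⟩ = tauFbandE 0 ⟨15, by norm_num⟩
      norm_num [tauFbandE, tauFbandA, tauFbandC, Matrix.cons_val_two, Matrix.head_cons, Matrix.tail_cons]
    · show tauFbandE 2 ⟨16, by norm_num⟩ = tauFbandE 0 ⟨16, by norm_num⟩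
      norm_num [tauFbandE, tauFbandA, tauFbandC, Matrix.cons_val_two, Matrix.head_cons, Matrix.tail_cons]
    · show tauFbandE 2 ⟨17, by norm_num⟩ = tauFbandE 0 ⟨17, by norm_num⟩
      norm_num [tauFbandE, tauFbandA, tauFbandC, Matrix.cons_val_two, Matrix.head_cons, Matrix.tail_cons]

/-- The reduced (banded) region is a subset of the original graded region
(the paper's "the two reductions replace them by subsets"): each per-grade
constraint follows from the banded constraint at the corresponding union
level via antitonicity of `U_t`. -/
theorem banded_subset_gradedF : OmegaF ⊆ GradedF := by
  rintro t ⟨hs, hband⟩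
  refine ⟨hs, ?_, ?_, ?_⟩
  · rcases hband 0 with h | h
    · exact Or.inl h
    · exact Or.inr fun j =>
        le_trans (bigU_antitone hs.1 (uvec_phiA_le j)) (le_trans (h (phiA j)) (bandF_le_gradeA j))
  · rcases hband 1 with h | h
    · exact Or.inl h
    · exact Or.inr fun j =>
        le_trans (bigU_antitone hs.1 (uvec_phiB_le j)) (le_trans (h (phiB j)) (bandF_le_gradeB j))
  · rcases hband 2 with h | h
    · exact Or.inl h
    · exact Or.inr fun j =>
        le_trans (bigU_antitone hs.1 (uvec_phiC_le j)) (le_trans (h (phiC j)) (bandF_le_gradeC j))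

/-- G-side companion of `banded_subset_gradedF`: the reduced (banded, Table 2) region `Ω'` is a
subset of the original graded G-region — each per-grade constraint follows from the banded
constraint at the corresponding union level via antitonicity of `U_t` (Remark 5.4: the two
reductions replace the regions by subsets). -/
theorem banded_subset_gradedG : OmegaG ⊆ GradedG := by
  rintro t ⟨hs, hband⟩
  refine ⟨hs, ?_, ?_, ?_⟩
  · rcases hband 0 with h | h
    · exact Or.inl h
    · exact Or.inr fun j =>
        le_trans (bigU_antitone hs.1 (uvec_phiA_le j)) (le_trans (h (phiA j)) (bandG_le_gradeA j))
  · rcases hband 1 with h | h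
    · exact Or.inl h
    · exact Or.inr fun j =>
        le_trans (bigU_antitone hs.1 (uvec_phiB_le j)) (le_trans (h (phiB j)) (bandG_le_gradeB j))
  · rcases hband 2 with h | h
    · exact Or.inl h
    · exact Or.inr fun j =>
        le_trans (bigU_antitone hs.1 (uvec_phiC_le j)) (le_trans (h (phiC j)) (bandG_le_gradeC j))

/-- The banded F-columns are non-increasing in the band index (Remark 5.4:
the thresholds are band-wise minima, non-decreasing in the depth). -/
theorem tauFband_le_01 : ∀ l : Fin 54, tauFband 1 l ≤ tauFband 0 l := by
  intro l
  fin_cases l <;>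
    norm_num [tauFband, tauFbandE, tauFbandA, tauFbandB, Sc, eps, Matrix.cons_val_two,
      Matrix.head_cons, Matrix.tail_cons]

/-- The banded F-columns are non-increasing in the band index, second step: `τ^F_{3,l} ≤ τ^F_{2,l}`
for every union level `l` (Remark 5.4; cf. `tauFband_le_01`). -/
theorem tauFband_le_12 : ∀ l : Fin 54, tauFband 2 l ≤ tauFband 1 l := by
  intro l
  fin_cases l <;>
    norm_num [tauFband, tauFbandE, tauFbandB, tauFbandC, Sc, eps, Matrix.cons_val_two,
      Matrix.head_cons, Matrix.tail_cons]

/-- The sentinel entries: `u_54 = S + ρ₀` and threshold `0`. -/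
theorem uvecE_sentinel : uvecE ⟨54, by omega⟩ = Sc + rho0 := by
  norm_num [uvecE, Matrix.cons_val_two, Matrix.head_cons, Matrix.tail_cons]

/-- The sentinel entries of the three banded F-columns vanish: `τ^F_{g,54} = 0` (no constraint above
the last genuine level). -/
theorem tauFbandE_sentinel : ∀ g : Fin 3, tauFbandE g ⟨54, by omega⟩ = 0 := by
  intro g
  fin_cases g <;>
    norm_num [tauFbandE, tauFbandA, tauFbandB, tauFbandC, Matrix.cons_val_two,
      Matrix.head_cons, Matrix.tail_cons]

/-! ### The cover fact (Section 7.3 / Lemma 6.3) -/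

/-- If a point of `S·R_42` in depth band `b` violates some band-`b` level
constraint, it lies in a cover member: the two-level member of band `b` at
the largest violated level if that level is `≥ u_18 = 1/10`, else the
one-level whole-layer member there (Lemma 6.3). -/
private lemma cover_of_band (t : Fin 42 → ℝ) (hs : t ∈ scaledSimplex 42 Sc) (b : Fin 3)
    (hb : inBand b (∑ j, t j)) (l₀ : Fin 54)
    (hviol : tauFband b l₀ < bigU t (uvec l₀)) :
    ∃ m : Member, t ∈ Esets m := by
  classical
  set V : Finset (Fin 54) := Finset.univ.filter (fun l => tauFband b l < bigU t (uvec l))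
    with hVdef
  have hne : V.Nonempty := ⟨l₀, by simp [hVdef, hviol]⟩
  set L := V.max' hne with hLdef
  have hLviol : tauFband b L < bigU t (uvec L) := by
    have h : L ∈ Finset.univ.filter (fun l => tauFband b l < bigU t (uvec l)) :=
      V.max'_mem hne
    exact (Finset.mem_filter.mp h).2
  have hLmax : ∀ l : Fin 54, tauFband b l < bigU t (uvec l) → l ≤ L := by
    intro l hl
    exact V.le_max' l (by simp [hVdef, hl])
  by_cases h18 : L.1 < 18
  · -- one-level member at level L < 18
    refine ⟨.inr ⟨L.1, h18⟩, hs, ?_, ?_⟩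
    · -- Σt > S - ε_{2,1}: the point is in some band, hence in the layer
      have h1 : Sc - ∑ j, t j < eps2 b := hb.2
      have h2 : eps2 b ≤ eps2 0 := by
        fin_cases b
        · exact le_refl _
        · exact le_of_lt eps2_anti.2
        · exact le_of_lt (lt_trans eps2_anti.1 eps2_anti.2)
      linarith
    · -- the violated level, moved to the band-independent column 0
      have hcast : (Fin.castLE (by omega : (18 : ℕ) ≤ 54) (⟨L.1, h18⟩ : Fin 18)) = L :=
        Fin.ext rfl
      have hlow := tauFband_low_eq b ⟨L.1, h18⟩
      rw [hcast] at hlow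
      rw [hcast, ← hlow]
      exact hLviol
  · -- two-level member of band b at level L ≥ 18
    push Not at h18
    have hL54 : L.1 < 54 := L.2
    refine ⟨.inl (b, ⟨L.1 - 18, by omega⟩), hs, hb, ?_, ?_⟩
    · have htoU : toU ⟨L.1 - 18, by omega⟩ = L := by
        apply Fin.ext
        simp only [toU]
        omega
      rw [htoU]
      exact hLviol
    · have htoU : toU ⟨L.1 - 18, by omega⟩ = L := by
        apply Fin.ext
        simp only [toU]
        omega
      rw [htoU]
      by_cases htop : L.1 = 53
      · -- the top level: the sentinel condition holds vacuously on S·R_42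
        have h54 : L.succ = (⟨54, by omega⟩ : Fin 55) := by
          apply Fin.ext
          simp [Fin.val_succ, htop]
        rw [h54, uvecE_sentinel, tauFbandE_sentinel b, bigU_sentinel hs]
      · -- an interior level: maximality of L gives the next-level condition
        have hlt : L.1 + 1 < 54 := by omega
        have hnv : ¬(tauFband b ⟨L.1 + 1, hlt⟩ < bigU t (uvec ⟨L.1 + 1, hlt⟩)) := by
          intro hcon
          have hle : L.1 + 1 ≤ L.1 := hLmax _ hcon
          omega
        push Not at hnv
        have hsucc : L.succ = (⟨L.1 + 1, hlt⟩ : Fin 54).castSucc := by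
          apply Fin.ext
          simp [Fin.val_succ]
        rw [hsucc]
        exact hnv

/-- Section 7.3: the complement of the reduced region `Ω` in `S·R_42` is
covered by the 126 F-side members (3 bands × 36 two-level + 18 one-level). -/
theorem Esets_cover : scaledSimplex 42 Sc \ OmegaF ⊆ ⋃ m : Member, Esets m := by
  rintro t ⟨hs, hnot⟩
  have h1 : ¬(∀ g : Fin 3,
      (∑ j, t j) ≤ Sc - eps2 g ∨ ∀ l : Fin 54, bigU t (uvec l) ≤ tauFband g l) :=
    fun h => hnot ⟨hs, h⟩
  push Not at h1
  obtain ⟨g₀, hg₀, l₀, hl₀⟩ := h1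
  have hd0 : 0 ≤ Sc - ∑ j, t j := by have := hs.2; linarith
  have hde : Sc - ∑ j, t j < eps2 g₀ := by linarith
  rcases le_or_gt (eps2 2) (Sc - ∑ j, t j) with h2 | h2
  · rcases le_or_gt (eps2 1) (Sc - ∑ j, t j) with h1' | h1'
    · -- band 1 (deepest): the failing grade must be grade 1
      have hcol : tauFband 0 l₀ ≤ tauFband g₀ l₀ := by
        fin_cases g₀
        · exact le_refl _
        · exact absurd hde (not_lt.mpr h1')
        · exact absurd hde (not_lt.mpr (le_trans (le_of_lt eps2_anti.1) h1'))
      have hd1 : Sc - ∑ j, t j < eps2 0 := by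
        fin_cases g₀
        · exact hde
        · exact lt_trans hde eps2_anti.2
        · exact lt_trans hde (lt_trans eps2_anti.1 eps2_anti.2)
      obtain ⟨m, hm⟩ := cover_of_band t hs 0
        ⟨by simp only [bandLo, Matrix.cons_val_zero]; linarith, hd1⟩ l₀
        (lt_of_le_of_lt hcol hl₀)
      exact Set.mem_iUnion.mpr ⟨m, hm⟩
    · -- band 2: the failing grade cannot be grade 3
      have hcol : tauFband 1 l₀ ≤ tauFband g₀ l₀ := by
        fin_cases g₀
        · exact tauFband_le_01 l₀
        · exact le_refl _
        · exact absurd hde (not_lt.mpr h2)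
      obtain ⟨m, hm⟩ := cover_of_band t hs 1
        ⟨by simp only [bandLo, Matrix.cons_val_one, Matrix.cons_val_zero]; linarith, h1'⟩ l₀
        (lt_of_le_of_lt hcol hl₀)
      exact Set.mem_iUnion.mpr ⟨m, hm⟩
  · -- band 3 (nearest the top); its column is the band-wise minimum
    have hcol : tauFband 2 l₀ ≤ tauFband g₀ l₀ := by
      fin_cases g₀
      · exact le_trans (tauFband_le_12 l₀) (tauFband_le_01 l₀)
      · exact tauFband_le_12 l₀
      · exact le_refl _
    obtain ⟨m, hm⟩ := cover_of_band t hs 2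
      ⟨by simp only [bandLo, Matrix.cons_val_two, Matrix.head_cons, Matrix.tail_cons]; linarith,
       h2⟩ l₀ (lt_of_le_of_lt hcol hl₀)
    exact Set.mem_iUnion.mpr ⟨m, hm⟩

/-- Adequacy of the `MemberBins` structure: its bins cover `[τ₀, S]`, so a
bin family is a cover in the sense of Lemma 6.2 (`b_0 = τ₀`, increasing,
`b_n > S`). -/
theorem binSets_cover {t0 : ℝ} (mb : MemberBins t0) :
    ∀ x : ℝ, t0 ≤ x → x ≤ Sc → ∃ i : Fin mb.n, x ∈ binSet mb i := by
  intro x hx hxS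
  classical
  set W : Finset (Fin (mb.n + 1)) := Finset.univ.filter (fun i => mb.bnd i ≤ x) with hWdef
  have hne : W.Nonempty := ⟨0, by simp [hWdef, mb.first, hx]⟩
  set i₀ := W.max' hne with hi₀def
  have hmem : mb.bnd i₀ ≤ x := by
    have h : i₀ ∈ Finset.univ.filter (fun i => mb.bnd i ≤ x) := W.max'_mem hne
    exact (Finset.mem_filter.mp h).2
  have hmax : ∀ i, mb.bnd i ≤ x → i ≤ i₀ := fun i hi => W.le_max' i (by simp [hWdef, hi])
  have hne_last : i₀ ≠ Fin.last mb.n := by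
    intro hcon
    have h := mb.last
    rw [← hcon] at h
    linarith
  have hlt : i₀.1 < mb.n := by
    rcases lt_or_eq_of_le (Nat.lt_succ_iff.mp i₀.2) with h | h
    · exact h
    · exact absurd (Fin.ext h) hne_last
  refine ⟨⟨i₀.1, hlt⟩, ?_, ?_⟩
  · have hc : (⟨i₀.1, hlt⟩ : Fin mb.n).castSucc = i₀ := Fin.ext rfl
    rw [hc]
    exact hmem
  · by_contra hcon
    push Not at hcon
    have h : i₀.1 + 1 ≤ i₀.1 := hmax _ hcon
    omega

end Summit.Parity.GeneralizedHardyLittlewood.Theorems.Dhl42
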